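import Summits.BirchSwinnertonDyer.Rank1Residual.X2.NonPrimitiveSelmerStrictEquality
import Summits.BirchSwinnertonDyer.Rank1Residual.X2.GreenbergVatsalTransferMultiplicative
import Literature.NumberTheory.EllipticCurves.GreenbergVatsal2000.GreenbergSelmerGroups
import Literature.NumberTheory.EllipticCurves.KummerSelmerStructure
import Mathlib.RingTheory.RootsOfUnity.AlgebraicallyClosed
import HarnessLib

/-!
# The Tate datum `C ≅ μ_{p^∞}` is COFREE OF CORANK ONE (`C` divisible, `#C[p] = p`), and the full
# Tate data package at an odd `p ‖ N` (split / non-split) for GV's §2 statements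

HONEST FRAMING (cell `b2b-bsdres`, run/shared/lean/b2b/bsd-rank1-residual/, verbatim in every
file): the goal of the cell is to DELETE the COMBINATION-SHAPED residual classes of the
Birch–Swinnerton-Dyer formula for ALL analytic-rank `≤ 1` elliptic curves over `ℚ` — "full BSD
formula for every rank `≤ 1` curve in class `C`" assembled STRICTLY from published theorems — so
that the rank-`≤ 1` remainder becomes exactly the CONSTRUCTION-SHAPED classes, which are TYPED
(missing-input `Prop`s), NOT attempted. This is not "finishing BSD". Sub-cell
`b2b-bsdres-eisenstein-p2` (CLASS-OWNERS row "X2"), gen 13: research route; NO CLAIM BEYOND STATED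
CLASSES; nothing here changes a label. Theorems only; axioms standard; no `sorry`.

WHAT THIS FILE PROVES (step K-B1 of the `p ‖ N` Λ-bookkeeping for route G, X2-GAP §16.6/§17.4).
Greenberg–Vatsal's §2 statements (Prop. (2.5)/p. 25 — Literature fact
`datumSelmer_divisible_of_finite_torsionBy`; p. 15 — `datumStrictSelmer_lt_datumSelmer_of_split`)
are typed for a Greenberg datum `C ⊂ A = E[p^∞]` of GV's shape "`C` = image of a
`G_{ℚ_p}`-invariant LINE" — `C` divisible with `#(C ∩ A[p]) = p` — with `D = A/C` unramified. Here:
* §0 the Literature objects `datumSelmer`/`datumStrictSelmer` (`GreenbergSelmerGroups`) ARE the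
  cell's `gvSelmer` (gen 8) / `gvStrictSelmer` (gen 12): `rfl`;
* §1 `exists_primaryTorsion_pointsMap_eq`: a `p`-power torsion point of `E(K̄_v)` comes from
  `E[p^∞](K̄)` (torsion is algebraic, `torsionPointsEquiv`);
* §2 **`tateDatum_plus_divisible`**: the Tate datum `C = ι⁻¹Φ(μ)` is `p`-DIVISIBLE (`p`-th roots of
  roots of unity exist in `K̄_v`); **`natCard_tateDatum_plus_inf_torsionBy`**: `#(C ∩ E[p^∞][p]) = p`
  (`C[p] = ι⁻¹Φ(μ_p) ≅ μ_p(K̄_v)`, `Φ` injective on roots of unity, `#μ_p = p`) — GV p. 14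
  "`C ≅ μ_{p^∞}`", i.e. `W_p` is a LINE;
* §3 **`exists_data_of_not_split` / `exists_data_of_split`**: at an odd non-split / split `p ‖ N`
  of `E/ℚ`, ONE Tate data `L` above `p` carrying ALL the properties the gen-13 count needs — GV's
  `htriv`, `hgen` (`I_p` moves every point of `C[p]`), the corank-one shape, the two Kummer/strict
  inclusions `localKerOver ≤ strictKer ≤ localKerOver`, and `greenbergKer = strictKer` (non-split)
  resp. `D_v` trivial on `D` (split) — granted only the Tate uniformisation facts A41 / A40.

References: Greenberg–Vatsal 2000 §2 pp. 14–16, 23–26; Silverman *ATAEC* V.3.1, V.5.3; *AEC* III.6.4.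
-/

noncomputable section

open scoped Classical AddSubgroup

universe u

namespace Summit.BirchSwinnertonDyer.Rank1Residual.X2.GreenbergVatsalTateDatumCofree

open NumberField IsDedekindDomain Field Literature.NumberTheory.GaloisRepresentations
  Literature.NumberTheory.EllipticCurves Literature.NumberTheory.EllipticCurves.GreenbergSelmer
  Literature.NumberTheory.EllipticCurves.GreenbergVatsal2000 IsDedekindDomain.HeightOneSpectrum
  Summit.BirchSwinnertonDyer.Rank1Residual.X2.GreenbergVatsalTorsion
  Summit.BirchSwinnertonDyer.Rank1Residual.X2.GreenbergVatsalTateDatum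
  Summit.BirchSwinnertonDyer.Rank1Residual.X2.GreenbergVatsalTateDatumSign
  Summit.BirchSwinnertonDyer.Rank1Residual.X2.GreenbergVatsalTateDatumTorsion
  Summit.BirchSwinnertonDyer.Rank1Residual.X2.GreenbergVatsalStrictSelmer
  Summit.BirchSwinnertonDyer.Rank1Residual.X2.GreenbergVatsalTateKummer
  Summit.BirchSwinnertonDyer.Rank1Residual.X2.GreenbergVatsalStrictSelmerMultiplicative

/-! ## §0. The Literature objects are the cell's objects (definitional) -/

section Bridge

variable {K : Type u} [Field K] [NumberField K] (H : Subgroup (absoluteGaloisGroup K)) [H.Normal]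
  (M : Type u) [AddCommGroup M] [DistribMulAction (absoluteGaloisGroup K) M] [TopologicalSpace M]
  [DiscreteTopology M] (p : ℕ) (L : Data K M p) (S₀ : Set (HeightOneSpectrum (𝓞 K)))

/-- `gvSelmer` (gen 8, Summits) IS the Literature `datumSelmer` (same formula).
[cite: GreenbergVatsal2000, §2 pp. 16–17, 20] -/
theorem gvSelmer_eq_datumSelmer : gvSelmer H M p L S₀ = datumSelmer H M p L S₀ := rfl

/-- `gvStrictSelmer` (gen 12, Summits) IS the Literature `datumStrictSelmer`.
[cite: GreenbergVatsal2000, §2 pp. 15, 20] -/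
theorem gvStrictSelmer_eq_datumStrictSelmer :
    gvStrictSelmer H M p L S₀ = datumStrictSelmer H M p L S₀ := rfl

/-- `gvSelmerInfty κ = datumSelmerInfty κ`. [cite: GreenbergVatsal2000, §2 pp. 16–17, 20] -/
theorem gvSelmerInfty_eq_datumSelmerInfty [Fact p.Prime] (κ : ZpExtension K p) :
    gvSelmerInfty κ M L S₀ = datumSelmerInfty κ M L S₀ := rfl

/-- `gvStrictSelmerInfty κ = datumStrictSelmerInfty κ`. [cite: GreenbergVatsal2000, §2 pp. 15, 20] -/
theorem gvStrictSelmerInfty_eq_datumStrictSelmerInfty [Fact p.Prime] (κ : ZpExtension K p) :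
    gvStrictSelmerInfty κ M L S₀ = datumStrictSelmerInfty κ M L S₀ := rfl

end Bridge

/-! ## §1. `p`-power torsion of `E(K̄_v)` comes from `E[p^∞](K̄)` -/

section Lift

variable {K : Type u} [Field K] [NumberField K] (W : WeierstrassCurve K) [W.IsElliptic] (p : ℕ)
  [hp : Fact p.Prime] {E : Type u} [Field E] [Algebra K E]

/-- **A `p^k`-torsion point of `E(K̄_E)` is `ι m` for some `m ∈ E[p^∞](K̄)`** (torsion points are
algebraic: the tree's `torsionPointsEquiv`, Silverman *AEC* III.6.4). [cite: SilvermanAEC2009, Cor. III.6.4(b)] -/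
theorem exists_primaryTorsion_pointsMap_eq (T : localPoints W E) (k : ℕ) (hT : p ^ k • T = 0) :
    ∃ m : W.geomPrimaryTorsion p, pointsMap W E (m : W.geomPoints) = T := by
  have hn : ((p ^ k : ℕ) : ℤ) ≠ 0 := by exact_mod_cast pow_ne_zero k hp.out.ne_zero
  have hT' : T ∈ AddSubgroup.torsionBy (localPoints W E) ((p ^ k : ℕ) : ℤ) := by
    rw [AddSubgroup.torsionBy, Submodule.mem_toAddSubgroup, Submodule.mem_torsionBy_iff]
    change ((p ^ k : ℕ) : ℤ) • T = 0
    rw [natCast_zsmul]; exact hT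
  set P := (W.torsionPointsEquiv ((p ^ k : ℕ) : ℤ) (E := E) hn).symm ⟨T, hT'⟩ with hP
  have hPmem : (P.1 : W.geomPoints) ∈ W.geomPrimaryTorsion p := by
    rw [WeierstrassCurve.geomPrimaryTorsion, AddCommGroup.mem_primaryComponent]
    refine ⟨k, ?_⟩
    have h := (W.mem_geomTorsion_iff ((p ^ k : ℕ) : ℤ) P.1).mp P.2
    rwa [natCast_zsmul] at h
  refine ⟨⟨P.1, hPmem⟩, ?_⟩
  change pointsMap W E P.1 = T
  have h := W.pointsMap_torsionPointsEquiv_symm ((p ^ k : ℕ) : ℤ) (E := E) hn ⟨T, hT'⟩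
  rw [← hP] at h
  exact h

end Lift

/-! ## §2. The Tate datum is divisible with `#C[p] = p` -/

section Cofree

variable {K : Type u} [Field K] [NumberField K] (W : WeierstrassCurve K) [W.IsElliptic] (p : ℕ)
  [hp : Fact p.Prime] {v : HeightOneSpectrum (𝓞 K)}
  (Φ : Additive (AlgebraicClosure (v.adicCompletion K))ˣ →+ localPoints W (v.adicCompletion K))
  (hΦ : ∀ (σ : absoluteGaloisGroup (v.adicCompletion K))
    (u : (AlgebraicClosure (v.adicCompletion K))ˣ),
    σ • Φ (Additive.ofMul u) = Φ (Additive.ofMul (Units.map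
      (Field.absoluteGaloisGroup.toAlgEquiv (v.adicCompletion K) σ :
        AlgebraicClosure (v.adicCompletion K) →* AlgebraicClosure (v.adicCompletion K)) u)) ∨
    σ • Φ (Additive.ofMul u) = -Φ (Additive.ofMul (Units.map
      (Field.absoluteGaloisGroup.toAlgEquiv (v.adicCompletion K) σ :
        AlgebraicClosure (v.adicCompletion K) →* AlgebraicClosure (v.adicCompletion K)) u)))
  {q : v.adicCompletion K} (hq0 : q ≠ 0) (hq1 : Valued.v q < 1)
  (hker : ∀ u : (AlgebraicClosure (v.adicCompletion K))ˣ, Φ (Additive.ofMul u) = 0 →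
    ∃ a : ℤ, (u : AlgebraicClosure (v.adicCompletion K)) =
      algebraMap (v.adicCompletion K) (AlgebraicClosure (v.adicCompletion K)) q ^ a)

omit [W.IsElliptic] hp in
/-- `ι = pointsMap ∘ subtype` is injective on `E[p^∞](K̄)`. [folklore] -/
theorem pointsMap_coe_injective :
    Function.Injective fun m : W.geomPrimaryTorsion p ↦
      pointsMap W (v.adicCompletion K) (m : W.geomPoints) := by
  intro m m' h
  exact Subtype.ext (pointsMapOfEmb_injective W (closureEmb (K := K) (v.adicCompletion K)) h)

/-- **The Tate datum `C = ι⁻¹Φ(μ)` is `p`-divisible** (`C ≅ μ_{p^∞}(K̄_v)`, GV p. 14): if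
`ι m = Φ(ζ)` with `ζ` a root of unity, pick `ξ` with `ξ^p = ζ` in the algebraically closed `K̄_v`;
`Φ(ξ)` is `p`-power torsion, hence `= ι m'` (§1), `m' ∈ C` and `p m' = m` (`ι` injective).
[cite: GreenbergVatsal2000, §2 p. 14] [cite: SilvermanATAEC1994, Ch. V Thm. 3.1 (c),(d)] -/
theorem tateDatum_plus_divisible :
    ∀ m ∈ (tateDatum W p Φ hΦ).plus, ∃ m' ∈ (tateDatum W p Φ hΦ).plus, p • m' = m := by
  intro m hm
  obtain ⟨ζ, hζ, hζm⟩ := (mem_tateDatum_plus_iff hΦ m).1 hm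
  -- a `p`-th root `ξ` of `ζ`
  obtain ⟨x, hx⟩ := IsAlgClosed.exists_pow_nat_eq (ζ : AlgebraicClosure (v.adicCompletion K))
    hp.out.pos
  have hx0 : x ≠ 0 := by
    rintro rfl
    rw [zero_pow hp.out.ne_zero] at hx
    exact ζ.ne_zero hx.symm
  set ξ : (AlgebraicClosure (v.adicCompletion K))ˣ := Units.mk0 x hx0 with hξ
  have hξp : ξ ^ p = ζ := Units.ext (by rw [Units.val_pow_eq_pow_val, Units.val_mk0, hx])
  have hξfin : IsOfFinOrder ξ := by
    obtain ⟨n, hn, hζn⟩ := isOfFinOrder_iff_pow_eq_one.1 hζ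
    exact isOfFinOrder_iff_pow_eq_one.2 ⟨p * n, Nat.mul_pos hp.out.pos hn,
      by rw [pow_mul, hξp, hζn]⟩
  -- `Φ(ξ)` is `p`-power torsion: `p^{k+1} Φ(ξ) = p^k ι m = 0`
  obtain ⟨k, hk⟩ := (AddCommGroup.mem_primaryComponent).1 m.2
  have hT : p ^ (k + 1) • Φ (Additive.ofMul ξ) = 0 := by
    rw [pow_succ, mul_nsmul', ← map_nsmul Φ p (Additive.ofMul ξ), ← ofMul_pow, hξp, hζm,
      ← map_nsmul, hk, map_zero]
  obtain ⟨m', hm'⟩ := exists_primaryTorsion_pointsMap_eq W p (Φ (Additive.ofMul ξ)) (k + 1) hT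
  refine ⟨m', (mem_tateDatum_plus_iff hΦ m').2 ⟨ξ, hξfin, hm'.symm⟩, ?_⟩
  apply pointsMap_coe_injective W p
  change pointsMap W (v.adicCompletion K) ((p • m' : W.geomPrimaryTorsion p) : W.geomPoints) =
    pointsMap W (v.adicCompletion K) (m : W.geomPoints)
  rw [AddSubmonoidClass.coe_nsmul, map_nsmul, hm', ← map_nsmul, ← ofMul_pow, hξp, hζm]

include hq0 hq1 hker in
/-- **`#(C ∩ E[p^∞][p]) = p` for the Tate datum**: `C[p] = ι⁻¹Φ(μ_p)` (a point of `C` killed by `p`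
is `Φ(ζ)` with `ζ^p ∈ q^ℤ ∩ μ = 1`), `Φ` is injective on roots of unity (`μ ∩ q^ℤ = 1`,
`0 < |q|_v < 1`), and `#μ_p(K̄_v) = p`. GV p. 14 "`C ≅ μ_{p^∞}`" — `W_p` is a LINE (`d⁺ = 1`).
[cite: GreenbergVatsal2000, §2 pp. 14, 16] [cite: SilvermanATAEC1994, Ch. V Thm. 3.1 (c),(d)] -/
theorem natCard_tateDatum_plus_inf_torsionBy :
    Nat.card ↥((tateDatum W p Φ hΦ).plus ⊓ (↥(W.geomPrimaryTorsion p))[(p : ℤ)]) = p := by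
  haveI : CharZero (v.adicCompletion K) :=
    Literature.NumberTheory.GaloisRepresentations.charZero_adicCompletion v
  haveI : NeZero ((p : ℕ) : v.adicCompletion K) := NeZero.charZero
  -- the map `μ_p → C[p]`
  have hmem : ∀ ζ : rootsOfUnity p (AlgebraicClosure (v.adicCompletion K)),
      p • Φ (Additive.ofMul (ζ : (AlgebraicClosure (v.adicCompletion K))ˣ)) = 0 := fun ζ ↦ by
    rw [← map_nsmul, ← ofMul_pow, show ((ζ : (AlgebraicClosure (v.adicCompletion K))ˣ)) ^ p = 1
      from (mem_rootsOfUnity p _).1 ζ.2, ofMul_one, map_zero]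
  have hlift : ∀ ζ : rootsOfUnity p (AlgebraicClosure (v.adicCompletion K)),
      ∃ m : W.geomPrimaryTorsion p, pointsMap W (v.adicCompletion K) (m : W.geomPoints) =
        Φ (Additive.ofMul (ζ : (AlgebraicClosure (v.adicCompletion K))ˣ)) := fun ζ ↦
    exists_primaryTorsion_pointsMap_eq W p _ 1 (by rw [pow_one]; exact hmem ζ)
  choose lift hlift using hlift
  have hfin : ∀ ζ : rootsOfUnity p (AlgebraicClosure (v.adicCompletion K)),
      IsOfFinOrder (ζ : (AlgebraicClosure (v.adicCompletion K))ˣ) := fun ζ ↦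
    isOfFinOrder_iff_pow_eq_one.2 ⟨p, hp.out.pos, (mem_rootsOfUnity p _).1 ζ.2⟩
  have hliftC : ∀ ζ, lift ζ ∈ (tateDatum W p Φ hΦ).plus := fun ζ ↦
    (mem_tateDatum_plus_iff hΦ _).2 ⟨_, hfin ζ, (hlift ζ).symm⟩
  have hliftp : ∀ ζ, lift ζ ∈ (↥(W.geomPrimaryTorsion p))[(p : ℤ)] := fun ζ ↦ by
    rw [AddSubgroup.torsionBy, Submodule.mem_toAddSubgroup, Submodule.mem_torsionBy_iff]
    change (p : ℤ) • lift ζ = 0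
    rw [natCast_zsmul]
    apply pointsMap_coe_injective W p
    change pointsMap W (v.adicCompletion K) ((p • lift ζ : W.geomPrimaryTorsion p) : W.geomPoints) =
      pointsMap W (v.adicCompletion K) ((0 : W.geomPrimaryTorsion p) : W.geomPoints)
    rw [AddSubmonoidClass.coe_nsmul, map_nsmul, hlift, hmem, ZeroMemClass.coe_zero, map_zero]
  let f : rootsOfUnity p (AlgebraicClosure (v.adicCompletion K)) →
      ↥((tateDatum W p Φ hΦ).plus ⊓ (↥(W.geomPrimaryTorsion p))[(p : ℤ)]) :=
    fun ζ ↦ ⟨lift ζ, AddSubgroup.mem_inf.2 ⟨hliftC ζ, hliftp ζ⟩⟩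
  have hf : Function.Bijective f := by
    constructor
    · intro ζ ζ' h
      have h1 : lift ζ = lift ζ' := congrArg Subtype.val h
      have h2 : Φ (Additive.ofMul (ζ : (AlgebraicClosure (v.adicCompletion K))ˣ)) =
          Φ (Additive.ofMul (ζ' : (AlgebraicClosure (v.adicCompletion K))ˣ)) := by
        rw [← hlift ζ, ← hlift ζ', h1]
      exact Subtype.ext (GreenbergVatsalTateKummerLocal.eq_of_isOfFinOrder_of_map_eq W Φ hker hq0
        hq1 (hfin ζ) (hfin ζ') h2)
    · rintro ⟨c, hc⟩
      obtain ⟨hcC, hcp⟩ := AddSubgroup.mem_inf.1 hc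
      have hpc : p • c = 0 := by
        have h := hcp
        rw [AddSubgroup.torsionBy, Submodule.mem_toAddSubgroup, Submodule.mem_torsionBy_iff] at h
        change (p : ℤ) • c = 0 at h
        rwa [natCast_zsmul] at h
      -- `ι c = Φ(ζ)` with `ζ^p ∈ q^ℤ` a root of unity, hence `ζ^p = 1`
      obtain ⟨ζ, hζfin, hζc⟩ := (mem_tateDatum_plus_iff hΦ c).1 hcC
      have hζp : ζ ^ p = 1 := by
        have h0 : Φ (Additive.ofMul (ζ ^ p)) = 0 := by
          rw [ofMul_pow, map_nsmul, hζc, ← map_nsmul, ← AddSubmonoidClass.coe_nsmul, hpc,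
            ZeroMemClass.coe_zero, map_zero]
        exact GreenbergVatsalTateKummerLocal.eq_one_of_isOfFinOrder_of_map_eq_zero W Φ hker hq0 hq1
          hζfin.pow h0
      refine ⟨⟨ζ, (mem_rootsOfUnity p ζ).2 hζp⟩, Subtype.ext ?_⟩
      change lift _ = c
      apply pointsMap_coe_injective W p
      change pointsMap W (v.adicCompletion K) ((lift _ : W.geomPrimaryTorsion p) : W.geomPoints) = _
      rw [hlift]; exact hζc
  rw [← Nat.card_eq_of_bijective f hf]
  exact HasEnoughRootsOfUnity.natCard_rootsOfUnity _ p

end Cofree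

/-! ## §3. The full Tate data packages at an odd `p ‖ N` over `ℚ` -/

section Rat

variable (W : WeierstrassCurve ℚ) [W.IsGloballyMinimal] [W.IsElliptic] (p : ℕ) [hp : Fact p.Prime]
  (κ : ZpExtension ℚ p)

/-- **NON-SPLIT odd `p ‖ N`: one Tate data above `p` with ALL the properties** — `htriv` ("`I_p`
trivial on `D`"), `hgen` ("`I_p` moves every point of `C[p]`"), `C` divisible with `#C[p] = p`,
`greenbergKer = strictKer` over `ℚ_∞` (no trivial zero, gen 12), and the two Kummer/strict
inclusions `localKerOver ≤ strictKer ≤ localKerOver` (Greenberg p. 76, gen 12 kernel) — granted only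
the twisted Tate uniformisation A41 (`hT`). [cite: GreenbergVatsal2000, §2 pp. 14–16, 26]
[cite: SilvermanATAEC1994, Ch. V Lemma 5.2 (c), Thm. 5.3 (a),(b), Cor. 5.4 (held copy PDF pp. 406–410)] -/
theorem exists_data_of_not_split
    (hT : Silverman1994_thmV53_corV54_tateUniformisation.{0}) (hκ : κ.IsCyclotomic) (hp2 : p ≠ 2)
    (hmult : W.HasMultiplicativeReductionAtPrime p) (hns : ¬ W.HasSplitMultiplicativeReductionAtPrime p) :
    ∃ L : Data ℚ (W.geomPrimaryTorsion p) p,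
      (∀ (v : HeightOneSpectrum (𝓞 ℚ)) (hv : ((p : ℕ) : 𝓞 ℚ) ∈ v.asIdeal),
        ∀ x ∈ inertia v, ∀ m : W.geomPrimaryTorsion p, x • m - m ∈ (L v hv).plus) ∧
      (∀ (v : HeightOneSpectrum (𝓞 ℚ)) (hv : ((p : ℕ) : 𝓞 ℚ) ∈ v.asIdeal),
        ∀ c ∈ (torsionData L p v hv).plus, ∃ τ ∈ inertia v,
          ∃ c' ∈ (torsionData L p v hv).plus, τ • c' - c' = c) ∧
      (∀ (v : HeightOneSpectrum (𝓞 ℚ)) (hv : ((p : ℕ) : 𝓞 ℚ) ∈ v.asIdeal),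
        (∀ c ∈ (L v hv).plus, ∃ c' ∈ (L v hv).plus, p • c' = c) ∧
          Nat.card ↥((L v hv).plus ⊓ (↥(W.geomPrimaryTorsion p))[(p : ℤ)]) = p) ∧
      (∀ (v : HeightOneSpectrum (𝓞 ℚ)) (hv : ((p : ℕ) : 𝓞 ℚ) ∈ v.asIdeal),
        (L v hv).greenbergKer κ.kerSubgroup = (L v hv).strictKer κ.kerSubgroup) ∧
      (∀ (v : HeightOneSpectrum (𝓞 ℚ)) (hv : ((p : ℕ) : 𝓞 ℚ) ∈ v.asIdeal),
        W.localKerOver p κ.kerSubgroup (v.adicCompletion ℚ) ≤ (L v hv).strictKer κ.kerSubgroup) ∧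
      (∀ (v : HeightOneSpectrum (𝓞 ℚ)) (hv : ((p : ℕ) : 𝓞 ℚ) ∈ v.asIdeal),
        (L v hv).strictKer κ.kerSubgroup ≤ W.localKerOver p κ.kerSubgroup (v.adicCompletion ℚ)) := by
  have key : ∀ (v : HeightOneSpectrum (𝓞 ℚ)) (hv : ((p : ℕ) : 𝓞 ℚ) ∈ v.asIdeal),
      ∃ N : LocalDatum ℚ (W.geomPrimaryTorsion p) v,
        (∀ x ∈ inertia v, ∀ m : W.geomPrimaryTorsion p, x • m - m ∈ N.plus) ∧
        (∀ c ∈ (torsionDatum N p).plus, ∃ τ ∈ inertia v,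
          ∃ c' ∈ (torsionDatum N p).plus, τ • c' - c' = c) ∧
        ((∀ c ∈ N.plus, ∃ c' ∈ N.plus, p • c' = c) ∧
          Nat.card ↥(N.plus ⊓ (↥(W.geomPrimaryTorsion p))[(p : ℤ)]) = p) ∧
        N.greenbergKer κ.kerSubgroup = N.strictKer κ.kerSubgroup ∧
        W.localKerOver p κ.kerSubgroup (v.adicCompletion ℚ) ≤ N.strictKer κ.kerSubgroup ∧
        N.strictKer κ.kerSubgroup ≤ W.localKerOver p κ.kerSubgroup (v.adicCompletion ℚ) := by
    intro v hv
    obtain ⟨q, t, Ψ, hq0, hq1, -, ht2, hsurj, hker, hΨσ, -⟩ :=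
      hT W v (hasMultiplicativeReductionAt_of_mem W p hmult hv)
    have hΨI : ∀ σ ∈ absInertia (v.adicCompletion ℚ),
        ∀ u : (AlgebraicClosure (v.adicCompletion ℚ))ˣ,
        σ • Ψ (Additive.ofMul u) = Ψ (Additive.ofMul (Units.map
          (Field.absoluteGaloisGroup.toAlgEquiv (v.adicCompletion ℚ) σ :
            AlgebraicClosure (v.adicCompletion ℚ) →* AlgebraicClosure (v.adicCompletion ℚ)) u)) := by
      intro σ hσ u
      rw [hΨσ σ u, if_pos (GreenbergVatsalTateDatumRat.inertia_fix_sqrt_gamma W hp2 hmult hv t ht2 σ hσ),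
        one_zsmul]
    have ht0 : t ≠ 0 := by
      intro h0
      rw [h0] at ht2
      have h4 : W.c₄ = ((WeierstrassCurve.integralModelInt W).c₄ : ℚ) := by
        conv_lhs => rw [← WeierstrassCurve.map_integralModelInt W]
        rw [WeierstrassCurve.map_c₄, eq_intCast]
      have h6 : W.c₆ = ((WeierstrassCurve.integralModelInt W).c₆ : ℚ) := by
        conv_lhs => rw [← WeierstrassCurve.map_integralModelInt W]
        rw [WeierstrassCurve.map_c₆, eq_intCast]
      obtain ⟨-, hc₄⟩ := Additive.dvd_and_not_dvd_c₄_of_hasMultiplicativeReductionAtPrime W p hmult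
      have hc₆ := GreenbergVatsalTateDatumRat.not_dvd_c₆_of_hasMultiplicativeReductionAtPrime W hmult
      have hγ0 : (-(W.c₄ / W.c₆) : ℚ) = 0 := by
        have h := ht2.symm
        rw [zero_pow two_ne_zero, ← IsScalarTower.algebraMap_apply, map_eq_zero_iff _
          (algebraMap ℚ (AlgebraicClosure (v.adicCompletion ℚ))).injective] at h
        exact h
      rw [h4, h6, neg_eq_zero, div_eq_zero_iff, Int.cast_eq_zero, Int.cast_eq_zero] at hγ0
      rcases hγ0 with h | h
      · exact hc₄ (by rw [h]; exact dvd_zero _)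
      · exact hc₆ (by rw [h]; exact dvd_zero _)
    set N := tateDatum W p Ψ (sign_disj W Ψ t hΨσ) with hN
    have heq : N.greenbergKer κ.kerSubgroup = N.strictKer κ.kerSubgroup :=
      GreenbergVatsalStrictAtNonsplit.greenbergKer_eq_strictKer_tate_of_flip W p κ Ψ t hΨσ hsurj
        (fun u h ↦ (hker u).1 h) ht0 ht2 hκ hp2 hmult hns hv
    refine ⟨N, tateDatum_htriv W p Ψ _ hsurj (fun u h ↦ (hker u).1 h) hΨI,
      tateDatum_hgen W p Ψ _ hq0 hq1 (fun u h ↦ (hker u).1 h) hΨI hp2 hv,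
      ⟨tateDatum_plus_divisible W p Ψ _,
        natCard_tateDatum_plus_inf_torsionBy W p Ψ _ hq0 hq1 (fun u h ↦ (hker u).1 h)⟩,
      heq, ?_, ?_⟩
    · exact (GreenbergVatsalSelmerLink.localKerOver_le_greenbergKer W p κ.kerSubgroup N
        (tateDatum_kummer W p Ψ _ hsurj (fun u h ↦ (hker u).1 h) hΨI hq0 hq1)).trans heq.le
    · exact strictKer_le_localKerOver_tate W p Ψ t hq0 hq1 (fun u h ↦ (hker u).1 h) hΨσ N
        (mem_tateDatum_plus_iff _) κ.kerSubgroup hp2 (smul_sqrt_eq_or W t ht2)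
  choose N hN₁ hN₂ hN₃ hN₄ hN₅ hN₆ using key
  exact ⟨N, hN₁, hN₂, hN₃, hN₄, hN₅, hN₆⟩

omit [W.IsGloballyMinimal] in
/-- **SPLIT `p ‖ N` (`p` odd): one Tate data above `p` with ALL the properties** — `htriv`, `hgen`,
`C` divisible with `#C[p] = p`, `D_v` acts TRIVIALLY on `D` (untwisted parametrisation), and
`localKerOver ≤ strictKer ≤ localKerOver` — granted only A40 (`hT`).
[cite: GreenbergVatsal2000, §2 pp. 14–16]
[cite: SilvermanATAEC1994, Ch. V Thm. 3.1 (c),(d) p. 423 and §V.5 Thm. 5.3 (a),(b)] -/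
theorem exists_data_of_split
    (hT : Silverman1994_thmV53_tateUniformisation.{0}) (hp2 : p ≠ 2)
    (hsplit : W.HasSplitMultiplicativeReductionAtPrime p) :
    ∃ L : Data ℚ (W.geomPrimaryTorsion p) p,
      (∀ (v : HeightOneSpectrum (𝓞 ℚ)) (hv : ((p : ℕ) : 𝓞 ℚ) ∈ v.asIdeal),
        ∀ x ∈ inertia v, ∀ m : W.geomPrimaryTorsion p, x • m - m ∈ (L v hv).plus) ∧
      (∀ (v : HeightOneSpectrum (𝓞 ℚ)) (hv : ((p : ℕ) : 𝓞 ℚ) ∈ v.asIdeal),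
        ∀ c ∈ (torsionData L p v hv).plus, ∃ τ ∈ inertia v,
          ∃ c' ∈ (torsionData L p v hv).plus, τ • c' - c' = c) ∧
      (∀ (v : HeightOneSpectrum (𝓞 ℚ)) (hv : ((p : ℕ) : 𝓞 ℚ) ∈ v.asIdeal),
        (∀ c ∈ (L v hv).plus, ∃ c' ∈ (L v hv).plus, p • c' = c) ∧
          Nat.card ↥((L v hv).plus ⊓ (↥(W.geomPrimaryTorsion p))[(p : ℤ)]) = p) ∧
      (∀ (v : HeightOneSpectrum (𝓞 ℚ)) (hv : ((p : ℕ) : 𝓞 ℚ) ∈ v.asIdeal),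
        ∀ (δ : decomp (K := ℚ) v) (d : (L v hv).Gr), δ • d = d) ∧
      (∀ (v : HeightOneSpectrum (𝓞 ℚ)) (hv : ((p : ℕ) : 𝓞 ℚ) ∈ v.asIdeal),
        W.localKerOver p κ.kerSubgroup (v.adicCompletion ℚ) ≤ (L v hv).strictKer κ.kerSubgroup) ∧
      (∀ (v : HeightOneSpectrum (𝓞 ℚ)) (hv : ((p : ℕ) : 𝓞 ℚ) ∈ v.asIdeal),
        (L v hv).strictKer κ.kerSubgroup ≤ W.localKerOver p κ.kerSubgroup (v.adicCompletion ℚ)) := by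
  have key : ∀ (v : HeightOneSpectrum (𝓞 ℚ)) (hv : ((p : ℕ) : 𝓞 ℚ) ∈ v.asIdeal),
      ∃ N : LocalDatum ℚ (W.geomPrimaryTorsion p) v,
        (∀ x ∈ inertia v, ∀ m : W.geomPrimaryTorsion p, x • m - m ∈ N.plus) ∧
        (∀ c ∈ (torsionDatum N p).plus, ∃ τ ∈ inertia v,
          ∃ c' ∈ (torsionDatum N p).plus, τ • c' - c' = c) ∧
        ((∀ c ∈ N.plus, ∃ c' ∈ N.plus, p • c' = c) ∧
          Nat.card ↥(N.plus ⊓ (↥(W.geomPrimaryTorsion p))[(p : ℤ)]) = p) ∧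
        (∀ (δ : decomp (K := ℚ) v) (d : N.Gr), δ • d = d) ∧
        W.localKerOver p κ.kerSubgroup (v.adicCompletion ℚ) ≤ N.strictKer κ.kerSubgroup ∧
        N.strictKer κ.kerSubgroup ≤ W.localKerOver p κ.kerSubgroup (v.adicCompletion ℚ) := by
    intro v hv
    obtain ⟨q, Φ, hq0, hq1, hsurj, hker, hΦσ, -⟩ :=
      hT W v (hasSplitMultiplicativeReductionAt_of_mem W p hsplit hv)
    set N := tateDatum W p Φ (sign_disj W Φ 0 (sign_of_equivariant W Φ hΦσ)) with hN
    have htrivD : ∀ (δ : decomp (K := ℚ) v) (d : N.Gr), δ • d = d :=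
      smul_gr_eq_of_equivariant W p Φ hΦσ hsurj (fun u h ↦ (hker u).1 h)
    refine ⟨N, tateDatum_htriv W p Φ _ hsurj (fun u h ↦ (hker u).1 h) (fun σ _ u ↦ hΦσ σ u),
      tateDatum_hgen W p Φ _ hq0 hq1 (fun u h ↦ (hker u).1 h) (fun σ _ u ↦ hΦσ σ u) hp2 hv,
      ⟨tateDatum_plus_divisible W p Φ _,
        natCard_tateDatum_plus_inf_torsionBy W p Φ _ hq0 hq1 (fun u h ↦ (hker u).1 h)⟩,
      htrivD, ?_, ?_⟩
    · exact localKerOver_le_strictKer_of_kummer_all W p κ.kerSubgroup N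
        (tateDatum_kummer_all W p Φ hΦσ hsurj (fun u h ↦ (hker u).1 h) hq0 hq1)
    · exact strictKer_le_localKerOver_tate W p Φ 0 hq0 hq1 (fun u h ↦ (hker u).1 h)
        (sign_of_equivariant W Φ hΦσ) N (mem_tateDatum_plus_iff _) κ.kerSubgroup hp2
        (fun σ ↦ Or.inl (smul_zero σ))
  choose N hN₁ hN₂ hN₃ hN₄ hN₅ hN₆ using key
  exact ⟨N, hN₁, hN₂, hN₃, hN₄, hN₅, hN₆⟩

end Rat

end Summit.BirchSwinnertonDyer.Rank1Residual.X2.GreenbergVatsalTateDatumCofree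

end
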